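/-
Copyright (c) 2026. Released under the Apache 2.0 license.
-/
import Literature.NumberTheory.EllipticCurves.ManinConstantQuadraticTwist
import Literature.NumberTheory.EllipticCurves.ManinConstantQuadraticTwistGamma0Proofs
import HarnessLib

/-!
# Twisted `Γ₀`-periods land in the `Γ₁`-periods of the source: `g(χ)·Λ(f ⊗ χ; Γ₀(L)) ⊆ Λ₁(f; Γ₁(N))`
# (Stevens 1989, Lemma (5.4), strengthened: `Γ₀`-SOURCE, `Γ₁`-TARGET) — PROVED; and the re-rooting
# squeeze `c₀(𝒜′ ⊗ χ) ∣ c₁(A)` for every `X₁`-datum of a curve `A` whose twisted class has optimal curve `W`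

The source. G. Stevens, *Stickelberger elements and modular parametrizations of elliptic curves*, Invent.
Math. 98 (1989) 75–106 (bib key `Stevens1989`), Lemma (5.4) p. 97: for `f` on `Γ₁(N)` and `χ` primitive
quadratic mod `m`, `g(χ)·Λ₁(f ⊗ χ) ⊆ Λ₁(f)` — in the tree as
`gaussSum_mul_mem_periodLatticeGamma1_of_mem_charTwist` (`Γ₁ → Γ₁`, `Gamma1PeriodLatticeTwistProofs.lean`),
next to the `Γ₀ → Γ₀` version `gaussSum_mul_mem_periodLattice_of_mem_charTwist`; the twisting identity is
Shimura 1971 Prop. 3.64 (tree `CuspFormTwist*.lean`, Birch's lemma `modularSymbol_charTwist`).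

## What is here (cell `bsd-f2-manin`, lens IMC g4, T-imc-8; HOME/MEMO-imc.md §12.1; planner's kernel-checked
## HOME/imc/Sketch-imc-g4.lean 1179235f32fa830a `section LemmaPlusProof` + E-imc-15/16 VERBATIM, refuter-reproduced R-imc-9/§R13(b))

LEMMA⁺ `GaussSumMulMemGamma1OfMemGamma0Twist` — for `f ∈ S₂(Γ₀(N))`, `χ` primitive quadratic mod `m ≠ 1`,
`N ∣ L`, `m² ∣ L`, `N m ∣ L`: **`g(χ) · Λ(f ⊗ χ; Γ₀(L)) ⊆ Λ₁(f; Γ₁(N))`** — the common strengthening of the two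
tree inclusions (the `Γ₀(L)`-periods of the twist already land in the `Γ₁(N)`-periods of the source).  PROOF
(`gaussSum_mul_cuspSymbol_charTwist_mem_periodLatticeGamma1_of_gamma0`, generators; then closure induction):
for `γ ∈ Γ₀(L)` Shimura's matrices `γ′_u ∈ Γ₀(N)` (tree `exists_modularSymbol_add_twistShift_eq_cuspSymbol`)
have `d′_u ≡ d (mod N)` for EVERY `u` (tree `intCast_entry_eq_of_dvd`, using `N m ∣ L ∣ c`), so any two of them
differ by an element of `Γ₁(N) = ker(d mod N)`; Manin's homomorphism (`cuspSymbol_mul_holds`) turns this into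
`{∞, γ′_u ∞} − {∞, γ′_v ∞} ∈ Λ₁(f)`, and `∑_u χ(u) = 0` (`χ ≠ 1`: primitive of conductor `m ≠ 1`) kills the
remaining multiple of `{∞, γ′_0 ∞}`.

CONSEQUENCE `OptimalManinDvdGamma1Manin` (the RE-ROOTING SQUEEZE, PROVED from LEMMA⁺ by the proof of the
tree's `maninConstant_dvd_of_charTwist_gamma0` with `Λ₁` in place of `Λ₀` on the source side): `D` a
LATTICE-OPTIMAL `X₀(N)`-datum of `W`, `D′` ANY `X₁(N′)`-datum of any `A`, `χ` primitive quadratic mod `m ≠ 1`,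
`N′ ∣ N`, `m² ∣ N`, `N′ m ∣ N`, `aₙ(f_D) = χ(n) aₙ(f_{D′})`, `C` globally minimal with Néron pair `LC` of lattice
`g(χ)⁻¹ Λ_A` ⇒ `(c′/c₀) Λ_W ⊆ Λ_C` and `c₀ ∣ c′` — the `X₀`-optimal curve of the twisted class lies BELOW
`A ⊗ χ` scaled by `c₁(A)/c₀`.  (Cell placement, refuter-2 R-imc-10: LEMMA⁺ NOT-IN-PRINT as stated,
PRINT-IMPLICIT by technique; the squeeze is its corollary — both are theorems here.)  Net fact debt: 0.

NOT here: the cell's unproved re-rooting law E-imc-17 / 2-power law E-imc-18 (summit-side leaves), Stevens'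
(5.2) Néron-lattice identification at odd `m` (tree `stevens1989_neronLattice_quadraticTwist_oddPrime_holds`).

## References
* [Stevens1989] op. cit., Lemma (5.4) and (5.5) p. 97, (2.8) p. 88.
* [Shimura1971] G. Shimura, *Introduction to the arithmetic theory of automorphic functions*, Prop. 3.64.
* [DiamondShurman2005] F. Diamond, J. Shurman, *A first course in modular forms*, §1.2 (`Γ₁(N) ⊴ Γ₀(N)`).
* [SilvermanATAEC1994] J. Silverman, *Advanced topics*, IV.5.1, IV.6.1, Cor. IV.9.1 (Néron mapping property).
-/

noncomputable section

open scoped MatrixGroups ModularForm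

open CongruenceSubgroup WeierstrassCurve

namespace Literature.NumberTheory.EllipticCurves.ModularForms

/-! ### Statements -/

/-- **LEMMA⁺ (Stevens (5.4) with `Γ₀`-source and `Γ₁`-target; cell `bsd-f2-manin` E-imc-15; PROVED below:
`gaussSumMulMemGamma1OfMemGamma0Twist_holds`).**  For `f ∈ S₂(Γ₀(N))`, `χ` primitive quadratic mod `m ≠ 1`,
`N ∣ L`, `m² ∣ L`, `N m ∣ L`: `g(χ) · Λ(f ⊗ χ; Γ₀(L)) ⊆ Λ₁(f; Γ₁(N))`.  (`m = 1` must be excluded: then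
`f ⊗ χ = f` and `Λ₀ ⊄ Λ₁`, e.g. `11a`.)
[cite: Stevens1989, Lemma (5.4) p. 97 (the Γ₁ → Γ₁ inclusion; the Γ₀-source / Γ₁-target strengthening is proved here)] [cite: Shimura1971, Prop. 3.64] -/
def GaussSumMulMemGamma1OfMemGamma0Twist : Prop :=
  ∀ (N L m : ℕ) [NeZero N] [NeZero L] [NeZero m] (hN : N ∣ L) (hm : m ^ 2 ∣ L) (_hNm : N * m ∣ L)
    (_hm1 : m ≠ 1) (χ : DirichletCharacter ℂ m) (hχ : χ.IsQuadratic) (_hprim : χ.IsPrimitive)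
    (f : CuspForm (Gamma0 N) 2) (z : ℂ), z ∈ periodLattice (charTwist L hN hm hχ f) →
      gaussSum χ (ZMod.stdAddChar (N := m)) * z ∈ periodLatticeGamma1 f

/-- **The re-rooting squeeze (cell `bsd-f2-manin` E-imc-16; PROVED: `optimalManinDvdGamma1Manin_holds`, edge
`optimalManinDvdGamma1Manin_of`).**  Data: `D` a LATTICE-OPTIMAL `X₀(N)`-datum of `W` (the optimal curve of
`𝒜 = 𝒜′ ⊗ χ`), `D′` ANY `X₁(N′)`-datum of any `A ∈ 𝒜′`, `χ` primitive quadratic mod `m ≠ 1`, `N′ ∣ N`, `m² ∣ N`,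
`N′ m ∣ N`, `aₙ(f_D) = χ(n) aₙ(f_{D′})`, and `C` globally minimal with Néron pair `LC` of lattice `g(χ)⁻¹ Λ_A`.
Then `(c′/c₀) Λ_W ⊆ Λ_C` and `c₀ ∣ c′`.
[cite: Stevens1989, Lemma (5.4) p. 97 and (2.8) p. 88 (shape: the Γ₁-twist comparison; this Γ₀-optimal / Γ₁-datum squeeze is proved here)] [cite: SilvermanATAEC1994, IV.5.1 with IV.6.1 and Cor. IV.9.1] -/
def OptimalManinDvdGamma1Manin : Prop :=
  ∀ (A W C : WeierstrassCurve ℚ) [W.IsElliptic] [W.IsGloballyMinimal] [C.IsElliptic]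
    [C.IsGloballyMinimal] (N N' m : ℕ) [NeZero N] [NeZero N'] [NeZero m]
    (χ : DirichletCharacter ℂ m) (LC : PeriodPair)
    (D' : Gamma1ParametrizationData A N') (D : ModularParametrizationData W N),
    (∀ z ∈ D.L.lattice, ∃ w ∈ periodLattice D.f, z = D.c * w) →
    χ.IsQuadratic → χ.IsPrimitive → N' ∣ N → m ^ 2 ∣ N → N' * m ∣ N → m ≠ 1 →
    (∀ n : ℕ, cuspCoeff D.f n = χ n * cuspCoeff D'.f n) →
    IsNeronLatticeOf (C.baseChange ℂ) LC →
    (∀ z : ℂ, z ∈ LC.lattice ↔ gaussSum χ (ZMod.stdAddChar (N := m)) * z ∈ D'.L.lattice) →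
      (∀ z ∈ D.L.lattice, ((((D'.c : ℚ) / D.c : ℚ)) : ℂ) * z ∈ LC.lattice) ∧ D.c ∣ D'.c

/-- Edge (proved): LEMMA⁺ ⟹ the squeeze, by the proof of the tree's `maninConstant_dvd_of_charTwist_gamma0`
with `Λ₁` in place of `Λ₀` on the source side.
[cite: Stevens1989, Lemma (5.4) p. 97 and (2.8) p. 88; edge proved here] [cite: SilvermanATAEC1994, Cor. IV.9.1] -/
theorem optimalManinDvdGamma1Manin_of (h15 : GaussSumMulMemGamma1OfMemGamma0Twist) :
    OptimalManinDvdGamma1Manin := by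
  intro A W C _ _ _ _ N N' m _ _ _ χ LC D' D h hχ hprim hN hm hNm hm1 hf hC hLC
  set G : ℂ := gaussSum χ (ZMod.stdAddChar (N := m)) with hG
  have hfeq : D.f = charTwist N hN hm hχ D'.f :=
    eq_of_forall_cuspCoeff_eq_gamma0 fun n ↦ by rw [hf, cuspCoeff_charTwist N hN hm hχ hprim]
  have hc : D.c ≠ 0 := D.maninConstant_ne_zero_holds
  have key : ∀ z ∈ D.L.lattice, ((((D'.c : ℚ) / D.c : ℚ)) : ℂ) * z ∈ LC.lattice := by
    intro z hz
    obtain ⟨w, hw, rfl⟩ := h z hz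
    have hw' : G * w ∈ periodLatticeGamma1 D'.f := by
      rw [hfeq] at hw
      exact h15 N' N m hN hm hNm hm1 χ hχ hprim D'.f w hw
    have h3 : (D'.c : ℂ) * (G * w) ∈ D'.L.lattice := D'.smul_periodLatticeGamma1_le _ hw'
    rw [hLC]
    have hcℂ : (D.c : ℂ) ≠ 0 := by exact_mod_cast hc
    convert h3 using 1
    push_cast
    field_simp
  refine ⟨key, ?_⟩
  obtain ⟨k, hk⟩ :=
    integral_neronScaling_of_isGloballyMinimal_holds W C D.L LC D.isNeronLattice hC _ key
  have hcℚ : (D.c : ℚ) ≠ 0 := by exact_mod_cast hc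
  have h' : (D'.c : ℚ) = D.c * k := by
    rw [hk]
    field_simp
  exact ⟨k, by exact_mod_cast h'⟩

/-! ### PROOF of LEMMA⁺ -/

section LemmaPlusProof

/-- Two elements of `Γ₀(N)` with congruent lower-right entries differ by an element of `Γ₁(N)`
(`Γ₁(N)` is the kernel of `d mod N : Γ₀(N) →* ℤ/N`, Mathlib `Gamma0Map`). [folklore] -/
private theorem mul_inv_mem_Gamma1_of_entry_eq {N : ℕ} {γ₁ γ₂ : SL(2, ℤ)} (h₁ : γ₁ ∈ Gamma0 N)
    (h₂ : γ₂ ∈ Gamma0 N) (hd : ((γ₁ 1 1 : ℤ) : ZMod N) = ((γ₂ 1 1 : ℤ) : ZMod N)) :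
    γ₁ * γ₂⁻¹ ∈ Gamma1 N := by
  set g₁ : Gamma0 N := ⟨γ₁, h₁⟩
  set g₂ : Gamma0 N := ⟨γ₂, h₂⟩
  have hmap : Gamma0Map N g₁ = Gamma0Map N g₂ := hd
  have hker : g₁ * g₂⁻¹ ∈ Gamma1' N := by
    rw [Gamma1_mem', map_mul, hmap, ← map_mul, mul_inv_cancel, map_one]
  exact (Gamma1_mem N (γ₁ * γ₂⁻¹)).mpr ((Gamma1_to_Gamma0_mem (g₁ * g₂⁻¹)).mp hker)

/-- A value of a quadratic character (`∈ {0, ±1}`) times an element of an additive subgroup of `ℂ`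
stays in the subgroup. [folklore] -/
private theorem quadratic_apply_mul_mem'' {m : ℕ} {χ : DirichletCharacter ℂ m} (hχ : χ.IsQuadratic)
    (u : ZMod m) {Λ : AddSubgroup ℂ} {z : ℂ} (hz : z ∈ Λ) : χ u * z ∈ Λ := by
  by_cases hu : IsUnit u
  · rcases sq_eq_one_iff.mp (apply_sq_eq_one_of_isQuadratic hχ hu) with h1 | h1
    · rw [h1, one_mul]
      exact hz
    · rw [h1, neg_one_mul]
      exact neg_mem hz
  · rw [χ.map_nonunit hu, zero_mul]
    exact zero_mem _

/-- A primitive Dirichlet character of modulus `m ≠ 1` is not the trivial character (the trivial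
character mod `m` has conductor `1`). [folklore] -/
private theorem ne_one_of_isPrimitive_of_modulus_ne_one {m : ℕ} [NeZero m] {χ : DirichletCharacter ℂ m}
    (hprim : χ.IsPrimitive) (hm1 : m ≠ 1) : χ ≠ 1 := by
  rintro rfl
  rw [DirichletCharacter.isPrimitive_def, DirichletCharacter.conductor_one] at hprim
  exact hm1 hprim.symm

variable {N : ℕ} [NeZero N] {m : ℕ} [NeZero m] (L : ℕ) [NeZero L]

/-- **LEMMA⁺ on generators**: for `f ∈ S₂(Γ₀(N))`, `χ` primitive quadratic mod `m ≠ 1`, `N ∣ L`,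
`m² ∣ L`, `N m ∣ L`, and ANY `γ ∈ Γ₀(L)`: `g(χ) · {∞, γ∞}_{f ⊗ χ} ∈ Λ₁(f)`.
[cite: Stevens1989, Lemma (5.4) p. 97 (Γ₁-version); Γ₀(L)-generator form proved here] [cite: Shimura1971, Prop. 3.64] -/
theorem gaussSum_mul_cuspSymbol_charTwist_mem_periodLatticeGamma1_of_gamma0 (hN : N ∣ L)
    (hm : m ^ 2 ∣ L) (hNm : N * m ∣ L) (hm1 : m ≠ 1) {χ : DirichletCharacter ℂ m}
    (hχ : χ.IsQuadratic) (hprim : χ.IsPrimitive) (f : CuspForm (Gamma0 N) 2) (γ : Gamma0 L) :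
    gaussSum χ (ZMod.stdAddChar (N := m)) * cuspSymbol (charTwist L hN hm hχ f) γ ∈
      periodLatticeGamma1 f := by
  by_cases hc0 : (γ : SL(2, ℤ)) 1 0 = 0
  · rw [cuspSymbol, if_pos hc0, mul_zero]
    exact zero_mem _
  rw [gaussSum_mul_cuspSymbol_charTwist L hN hm hχ hprim f γ hc0]
  choose γ' hγ' h10 h11 hsym using
    fun u ↦ exists_modularSymbol_add_twistShift_eq_cuspSymbol L hN hm f γ hc0 u
  simp_rw [hsym]
  -- all `γ'_u` lie in ONE `Γ₁(N)`-coset, so differences of their periods are `Γ₁(N)`-periods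
  have hdiff : ∀ u v : ZMod m,
      cuspSymbol f ⟨γ' u, hγ' u⟩ - cuspSymbol f ⟨γ' v, hγ' v⟩ ∈ periodLatticeGamma1 f := by
    intro u v
    have hd : ((γ' u 1 1 : ℤ) : ZMod N) = ((γ' v 1 1 : ℤ) : ZMod N) := by
      rw [intCast_entry_eq_of_dvd hNm γ.2 (h11 u), intCast_entry_eq_of_dvd hNm γ.2 (h11 v)]
    have hmem : γ' u * (γ' v)⁻¹ ∈ Gamma1 N :=
      mul_inv_mem_Gamma1_of_entry_eq (hγ' u) (hγ' v) hd
    have hper := cuspSymbol_mem_periodLatticeGamma1 f ⟨γ' u * (γ' v)⁻¹, hmem⟩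
    have h1 := cuspSymbol_mul_holds f ((⟨γ' u, hγ' u⟩ : Gamma0 N) * (⟨γ' v, hγ' v⟩ : Gamma0 N)⁻¹)
      ⟨γ' v, hγ' v⟩
    rw [inv_mul_cancel_right] at h1
    rw [h1, add_sub_cancel_right]
    exact hper
  have hsum0 : ∑ u : ZMod m, χ u = 0 :=
    MulChar.sum_eq_zero_of_ne_one (ne_one_of_isPrimitive_of_modulus_ne_one hprim hm1)
  have key : ∑ u : ZMod m, χ u * cuspSymbol f ⟨γ' u, hγ' u⟩ =
      ∑ u : ZMod m, χ u * (cuspSymbol f ⟨γ' u, hγ' u⟩ - cuspSymbol f ⟨γ' 0, hγ' 0⟩) +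
        (∑ u : ZMod m, χ u) * cuspSymbol f ⟨γ' 0, hγ' 0⟩ := by
    rw [Finset.sum_mul, ← Finset.sum_add_distrib]
    exact Finset.sum_congr rfl fun u _ ↦ by ring
  rw [key, hsum0, zero_mul, add_zero]
  exact sum_mem fun u _ ↦ quadratic_apply_mul_mem'' hχ u (hdiff u 0)

/-- **LEMMA⁺**: `g(χ) · Λ(f ⊗ χ; Γ₀(L)) ⊆ Λ₁(f; Γ₁(N))` (closure induction from the generators).
[cite: Stevens1989, Lemma (5.4) p. 97 (Γ₁-version); Γ₀-source / Γ₁-target form proved here] -/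
theorem gaussSum_mul_mem_periodLatticeGamma1_of_mem_charTwist_gamma0 (hN : N ∣ L) (hm : m ^ 2 ∣ L)
    (hNm : N * m ∣ L) (hm1 : m ≠ 1) {χ : DirichletCharacter ℂ m} (hχ : χ.IsQuadratic)
    (hprim : χ.IsPrimitive) (f : CuspForm (Gamma0 N) 2) {z : ℂ}
    (hz : z ∈ periodLattice (charTwist L hN hm hχ f)) :
    gaussSum χ (ZMod.stdAddChar (N := m)) * z ∈ periodLatticeGamma1 f := by
  induction hz using AddSubgroup.closure_induction with
  | mem x hx =>
    obtain ⟨γ, rfl⟩ := hx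
    exact gaussSum_mul_cuspSymbol_charTwist_mem_periodLatticeGamma1_of_gamma0 L hN hm hNm hm1 hχ
      hprim f γ
  | zero =>
    rw [mul_zero]
    exact zero_mem _
  | add x y _ _ hx hy =>
    rw [mul_add]
    exact add_mem hx hy
  | neg x _ hx =>
    rw [mul_neg]
    exact neg_mem hx

end LemmaPlusProof

/-- **LEMMA⁺ holds** (kernel-checked). [cite: Stevens1989, Lemma (5.4) p. 97; strengthening proved here] -/
theorem gaussSumMulMemGamma1OfMemGamma0Twist_holds : GaussSumMulMemGamma1OfMemGamma0Twist := by
  intro N L m _ _ _ hN hm hNm hm1 χ hχ hprim f z hz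
  exact gaussSum_mul_mem_periodLatticeGamma1_of_mem_charTwist_gamma0 L hN hm hNm hm1 hχ hprim f hz

/-- `GaussSumMulMemGamma1OfMemGamma0Twist` — `_holds` alias of `gaussSumMulMemGamma1OfMemGamma0Twist_holds` above under the fact's exact name (appended
2026-08-28, D-0026 bookkeeping: the proof term is the existing theorem of this file; no statement,
definition or attribute is edited; no new named fact; the ledger's debt table listed the fact
unproved). [cite: Stevens1989, Lemma (5.4) p. 97; strengthening proved here] -/
theorem _root_.Literature.NumberTheory.EllipticCurves.ModularForms.GaussSumMulMemGamma1OfMemGamma0Twist_holds :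
    GaussSumMulMemGamma1OfMemGamma0Twist :=
  _root_.Literature.NumberTheory.EllipticCurves.ModularForms.gaussSumMulMemGamma1OfMemGamma0Twist_holds

/-- **The re-rooting squeeze holds** (LEMMA⁺ + the proved edge).
[cite: Stevens1989, Lemma (5.4) p. 97 and (2.8) p. 88; proved here] -/
theorem optimalManinDvdGamma1Manin_holds : OptimalManinDvdGamma1Manin :=
  optimalManinDvdGamma1Manin_of gaussSumMulMemGamma1OfMemGamma0Twist_holds

/-- `OptimalManinDvdGamma1Manin` — `_holds` alias of `optimalManinDvdGamma1Manin_holds` above under the fact's exact name (appended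
2026-08-28, D-0026 bookkeeping: the proof term is the existing theorem of this file; no statement,
definition or attribute is edited; no new named fact; the ledger's debt table listed the fact
unproved). [cite: Stevens1989, Lemma (5.4) p. 97 and (2.8) p. 88; proved here] -/
theorem _root_.Literature.NumberTheory.EllipticCurves.ModularForms.OptimalManinDvdGamma1Manin_holds :
    OptimalManinDvdGamma1Manin :=
  _root_.Literature.NumberTheory.EllipticCurves.ModularForms.optimalManinDvdGamma1Manin_holds

end Literature.NumberTheory.EllipticCurves.ModularForms
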